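import Mathlib
import HarnessLib

/-!
# Decoupling of the balancing condition on transversal overlays (kernel core)

Helper for crux K1 (`TropicalWeilVanishing`, stmt-HodgeConjecture-18478) of route `TropicalWeilObstruction` —
negation-sink work of cell `pub-hodge-tropical` (tropical-2 gen 18, HOME `certificates/overlays2/` §5,
the DECOUPLING LEMMA behind the n = 2 overlay census E1); it decides nothing about K1 and nothing here
bears on the Hodge conjecture.

Setting (informal): `K₁, …, K_k` complete polyhedral complexes on a tropical torus in transversal position,
`e = σ₁ ∩ … ∩ σ_k` a codimension-one cell of their common refinement. The top-dimensional cells at `e` of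
"kind `j`" are `σ'_j ∩ ⋂_{i ≠ j} σ_i` with `σ'_j ⊋ σ_j` a coface, so their in-pointing vectors — hence the
kind-`j` part `v_j` of the balancing sum — lie in `⋂_{i ≠ j} T_{σ_i}`. The balancing condition at `e` says
`Σ_j v_j ∈ T_e = ⋂_i T_{σ_i}`. The lemma below is the algebraic heart of the decoupling: then EVERY `v_j`
lies in `⋂_i T_{σ_i}`, i.e. each kind balances on its own; consequently the signed cycle space of a
transversal overlay is the direct sum, over complete-intersection types, of the cycle spaces of the
complete-intersection supports (HOME `certificates/overlays2/README.md` §5). No dimension count is needed.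

* `mem_of_forall_ne_mem_of_sum_mem` — if `v j ∈ T i` for all `i ≠ j` in `s` and `Σ_{j ∈ s} v j ∈ T i` for all
  `i ∈ s`, then `v j ∈ T i` for ALL `i, j ∈ s`;
* `mem_biInf_of_sum_eq_zero` — the balanced case `Σ v j = 0`: every `v j` lies in `⨅_{i ∈ s} T i`;
* `mem_biInf_of_mem_biInf_erase_of_sum_eq_zero` — the same with the hypothesis packaged as
  `v j ∈ ⨅_{i ∈ s.erase j} T i` (the space `V_j = ⋂_{i ≠ j} T_{σ_i}` of the lemma).

Pure linear algebra (any ring, any module, any finite index set). No definition, no named fact, no sorry.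
References: Mikhalkin–Zharkov, *Tropical eigenwave and intermediate Jacobians* (2014), §4 (balancing);
cell files `certificates/overlays2/` (E1) and `certificates/thetaskeleton/` (the single-sheet case).
-/

-- `Summit.HodgeConjecture.HodgeConjecture.…` is the mandated namespace (single-conjunct summit).
set_option linter.dupNamespace false

open scoped BigOperators

namespace Summit.HodgeConjecture.HodgeConjecture.Theorems.TropicalWeilVanishing.Decoupling

variable {R M ι : Type*} [Ring R] [AddCommGroup M] [Module R M]

/-- **Decoupling, membership form.** If the kind-`j` contribution `v j` lies in every OTHER space `T i`
(`i ≠ j`), and the total `Σ_{j ∈ s} v j` lies in every `T i`, then every contribution lies in every `T i`: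
`v j = (Σ_l v l) − Σ_{l ≠ j} v l` and both terms lie in `T j`. -/
theorem mem_of_forall_ne_mem_of_sum_mem (s : Finset ι) (T : ι → Submodule R M) (v : ι → M)
    (hv : ∀ j ∈ s, ∀ i ∈ s, i ≠ j → v j ∈ T i) (hsum : ∀ i ∈ s, (∑ j ∈ s, v j) ∈ T i) :
    ∀ j ∈ s, ∀ i ∈ s, v j ∈ T i := by
  classical
  intro j hj i hi
  by_cases hij : i = j
  · subst hij
    have h : v i = (∑ l ∈ s, v l) - ∑ l ∈ s.erase i, v l := by
      rw [← Finset.add_sum_erase s v hi]; abel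
    rw [h]
    refine Submodule.sub_mem _ (hsum i hi) (Submodule.sum_mem _ fun l hl => ?_)
    exact hv l (Finset.mem_of_mem_erase hl) i hi (Finset.ne_of_mem_erase hl).symm
  · exact hv j hj i hi hij

/-- **Decoupling, balanced form.** If `v j ∈ T i` for all `i ≠ j` in `s` and the contributions balance,
`Σ_{j ∈ s} v j = 0`, then each `v j` lies in the common intersection `⨅_{i ∈ s} T i` — each kind balances
on its own modulo `T_e`. -/
theorem mem_biInf_of_sum_eq_zero (s : Finset ι) (T : ι → Submodule R M) (v : ι → M)
    (hv : ∀ j ∈ s, ∀ i ∈ s, i ≠ j → v j ∈ T i) (hsum : ∑ j ∈ s, v j = 0) :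
    ∀ j ∈ s, v j ∈ ⨅ i ∈ s, T i := by
  intro j hj
  have h := mem_of_forall_ne_mem_of_sum_mem s T v hv
    (fun i _ => by rw [hsum]; exact Submodule.zero_mem _) j hj
  simp only [Submodule.mem_iInf]
  exact fun i hi => h i hi

/-- **Decoupling, with the spaces `V_j = ⨅_{i ≠ j} T i`.** If each contribution `v j` lies in
`⨅_{i ∈ s ∖ {j}} T i` and `Σ_{j ∈ s} v j = 0`, then each `v j` lies in `⨅_{i ∈ s} T i`. This is the form
used for overlays: `T i` = tangent space of the `i`-th carrier at the codimension-one cell, `V_j` = where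
the in-pointing vectors of the kind-`j` cells live. -/
theorem mem_biInf_of_mem_biInf_erase_of_sum_eq_zero [DecidableEq ι] (s : Finset ι) (T : ι → Submodule R M)
    (v : ι → M) (hv : ∀ j ∈ s, v j ∈ ⨅ i ∈ s.erase j, T i) (hsum : ∑ j ∈ s, v j = 0) :
    ∀ j ∈ s, v j ∈ ⨅ i ∈ s, T i := by
  refine mem_biInf_of_sum_eq_zero s T v (fun j hj i hi hij => ?_) hsum
  have h := hv j hj
  simp only [Submodule.mem_iInf] at h
  exact h i (Finset.mem_erase.mpr ⟨hij, hi⟩)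

end Summit.HodgeConjecture.HodgeConjecture.Theorems.TropicalWeilVanishing.Decoupling
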